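import Literature.Combinatorics.Designs.TSequences

/-!
# T-matrices (periodic T-sequences) and the Cooper–Wallis construction

[Seberry–Yamada, *Hadamard Matrices* (Wiley 2020)] (`SeberryYamada2020`) Definition 1.59: four circulant (or type one)
`(0, ±1)` matrices `T₁, …, T₄` of order `t` are *T-matrices* if `Tᵢ ∗ Tⱼ = 0` (`i ≠ j`, Hadamard product), `Σ Tᵢ` is a
`(1,-1)` matrix, and `Σ Tᵢ Tᵢᵀ = t I`.  For circulants these are conditions on the FIRST ROWS `t_k : ZMod t → ℤ`: in
each position exactly one `t_k` is non-zero and it is `±1`, and the PERIODIC autocorrelations sum to `0` off the origin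
— "a slightly weaker condition than T-sequences" (SY 2020 §1.16: T-matrices are known for orders, e.g. `61, 67`, for
which no T-sequences are known).  Theorem 3.10 (i): T-sequences, used as first rows of circulants, give T-matrices;
Theorem 3.11 (Cooper–J. Wallis): T-matrices give an `OD(4t; t, t, t, t)` and a Hadamard matrix of order `4t` through
`A = X₁+X₂+X₃+X₄, B = -X₁+X₂+X₃-X₄, C = -X₁-X₂+X₃+X₄, D = -X₁+X₂-X₃+X₄` in the Goethals–Seidel array.

PROVED here (general `t`, written `n`):
* `tmatrixRows_isHadamard` — first rows of circulant T-matrices ⇒ the four Cooper–Wallis rows are `±1` with periodic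
  autocorrelations summing to `0` off the origin ⇒ `IsHadamardMatrix (gsMatrix …)` of order `4n` [SY 2020 Thm 3.11];
* `tseq_tmatrixRows` — T-sequences of length `n`, read on `ZMod n`, are first rows of T-matrices [SY 2020 Thm 3.10 (i)],
  and the rows agree with `TSequences.cwSeq` (`cwRowZ_periodize`).
This is the weakest hypothesis of the T-sequence family (cell pub-namedobj, target H: T-matrices of order `167` are
absent from the known-orders list of SY 2020 §1.16).  No `sorry`, no new axioms.
-/

open Finset BigOperators Matrix

namespace Literature.Combinatorics.Designs.TMatrices

open Literature.Combinatorics.Designs.LegendrePairs (PAF IsPM)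
open Literature.Combinatorics.Designs.GoethalsSeidel (gsMatrix IsHadamardMatrix goethalsSeidel_isHadamard)
open Literature.Combinatorics.Designs.TSequences

variable {n : ℕ} [NeZero n]

/-- **first rows of circulant T-matrices** of order `n`: four `(0, ±1)` sequences on `ZMod n` with exactly one
non-zero (`±1`) entry in each position (`Tᵢ ∗ Tⱼ = 0`, `Σ Tᵢ` a `(1,-1)` matrix) and periodic autocorrelations summing
to `0` at every non-zero shift (`Σ Tᵢ Tᵢᵀ = n I`). [cite: SeberryYamada2020, Definition 1.59] -/
def IsTMatrixRows (n : ℕ) [NeZero n] (t : Fin 4 → ZMod n → ℤ) : Prop :=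
  (∀ i, ∃ k, (t k i = 1 ∨ t k i = -1) ∧ ∀ k', k' ≠ k → t k' i = 0) ∧
    ∀ s : ZMod n, s ≠ 0 → ∑ k, PAF (t k) s = 0

/-- the Cooper–Wallis rows `Σ_k ε_{pk} t_k` on `ZMod n` (first rows of `A, B, C, D` of Theorem 3.11 at `a=b=c=d=1`).
[cite: SeberryYamada2020, Theorem 3.11 (Cooper–J. Wallis)] -/
def cwRowZ (t : Fin 4 → ZMod n → ℤ) (p : Fin 4) : ZMod n → ℤ := fun i => ∑ k, cwSign p k * t k i

omit [NeZero n] in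
/-- pointwise orthogonality of the sign pattern on `ZMod n`-indexed rows: `Σ_p row_p(i) row_p(j) = 4 Σ_k t_k(i) t_k(j)`.
[cite: SeberryYamada2020, Theorem 3.11 (proof)] -/
lemma sum_cwRowZ_mul (t : Fin 4 → ZMod n → ℤ) (i j : ZMod n) :
    ∑ p, cwRowZ t p i * cwRowZ t p j = 4 * ∑ k, t k i * t k j := by
  simp [cwRowZ, cwSign, Fin.sum_univ_four]
  ring

/-- `Σ_p P_{row_p}(s) = 4 Σ_k P_{t_k}(s)` (`Σ Yᵢ Yᵢᵀ = 4 Σ Xᵢ Xᵢᵀ`). [cite: SeberryYamada2020, Theorem 3.11 (proof)] -/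
lemma sum_paf_cwRowZ (t : Fin 4 → ZMod n → ℤ) (s : ZMod n) :
    ∑ p, PAF (cwRowZ t p) s = 4 * ∑ k, PAF (t k) s := by
  simp only [PAF]
  calc ∑ p, ∑ i, cwRowZ t p i * cwRowZ t p (i + s)
      = ∑ i, ∑ p, cwRowZ t p i * cwRowZ t p (i + s) := Finset.sum_comm
    _ = ∑ i, 4 * ∑ k, t k i * t k (i + s) := by simp_rw [sum_cwRowZ_mul]
    _ = 4 * ∑ i, ∑ k, t k i * t k (i + s) := by rw [Finset.mul_sum]
    _ = 4 * ∑ k, ∑ i, t k i * t k (i + s) := by rw [Finset.sum_comm]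

omit [NeZero n] in
/-- each Cooper–Wallis row is `±1` (`Σ Tᵢ` is a `(1,-1)` matrix). [cite: SeberryYamada2020, Definition 1.59 (ii)] -/
lemma isPM_cwRowZ {t : Fin 4 → ZMod n → ℤ} (h1 : ∀ i, ∃ k, (t k i = 1 ∨ t k i = -1) ∧ ∀ k', k' ≠ k → t k' i = 0)
    (p : Fin 4) : IsPM (cwRowZ t p) := by
  intro i
  obtain ⟨k, hk, h0⟩ := h1 i
  have hrow : cwRowZ t p i = cwSign p k * t k i := by
    unfold cwRowZ
    rw [Finset.sum_eq_single k]
    · intro k' _ hk'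
      rw [h0 k' hk', mul_zero]
    · intro h
      exact absurd (mem_univ k) h
  rw [hrow]
  rcases cwSign_pm p k with e1 | e1 <;> rcases hk with e2 | e2 <;> simp [e1, e2]

/-- **Cooper–Wallis for T-matrices.** First rows of circulant T-matrices of order `n` give, through the four sign
combinations and the Goethals–Seidel array, a Hadamard matrix of order `4n`. [cite: SeberryYamada2020, Theorem 3.11 (Cooper–J. Wallis)] -/
theorem tmatrixRows_isHadamard {t : Fin 4 → ZMod n → ℤ} (ht : IsTMatrixRows n t) :
    IsHadamardMatrix (gsMatrix (cwRowZ t 0) (cwRowZ t 1) (cwRowZ t 2) (cwRowZ t 3)) := by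
  refine goethalsSeidel_isHadamard _ _ _ _ (isPM_cwRowZ ht.1 0) (isPM_cwRowZ ht.1 1) (isPM_cwRowZ ht.1 2)
    (isPM_cwRowZ ht.1 3) fun s hs => ?_
  have h := sum_paf_cwRowZ t s
  rw [ht.2 s hs, mul_zero] at h
  simpa [Fin.sum_univ_four, add_assoc] using h

/-- existence form: T-matrices (first rows) of order `n` ⇒ a Hadamard matrix of order `4n`.
[cite: SeberryYamada2020, Theorem 3.11 (Cooper–J. Wallis)] -/
theorem exists_hadamard_of_tmatrixRows {t : Fin 4 → ZMod n → ℤ} (ht : IsTMatrixRows n t) :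
    ∃ H : Matrix (Fin 4 × ZMod n) (Fin 4 × ZMod n) ℤ, IsHadamardMatrix H :=
  ⟨_, tmatrixRows_isHadamard ht⟩

/-! ## T-sequences give T-matrices -/

omit [NeZero n] in
/-- the Cooper–Wallis rows of periodised T-sequences are the periodised Cooper–Wallis rows (`cwSeq`).
[cite: SeberryYamada2020, Theorem 3.10 (i)] -/
lemma cwRowZ_periodize (t : Fin 4 → ℕ → ℤ) (p : Fin 4) :
    cwRowZ (fun k => periodize n (t k)) p = cwSeq n t p := by
  funext i
  rfl

/-- **T-sequences give T-matrices**: T-sequences of length `n`, used as first rows of circulants of order `n`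
(`periodize`), are first rows of T-matrices (NPAF `= 0` ⇒ PAF `= 0`, Lemma 1.21 / Corollary 1.4).
[cite: SeberryYamada2020, Theorem 3.10 (i)] -/
theorem tseq_tmatrixRows {t : Fin 4 → ℕ → ℤ} (ht : IsTSeq n t) : IsTMatrixRows n (fun k => periodize n (t k)) := by
  refine ⟨fun i => ht.1 i.val (ZMod.val_lt i), fun s hs => ?_⟩
  have hv : s.val ≠ 0 := fun h => hs ((ZMod.val_eq_zero s).mp h)
  have hv' : n - s.val ≠ 0 := by
    have := ZMod.val_lt s
    omega
  simp only [paf_periodize, Finset.sum_add_distrib, ht.npaf hv, ht.npaf hv', add_zero]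

end Literature.Combinatorics.Designs.TMatrices
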